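import Summits.BirchSwinnertonDyer.BirchSwinnertonDyer.Theorems.Rank2ObservatoryReductionWitness3
import HarnessLib

/-!
# BirchSwinnertonDyer — rank ≥ 2 observatory: sharpening the torsion annihilator at a prime with no point of order 4

HONEST FRAMING: per-curve certified theorems and census instruments; no claim on BSD in rank ≥ 2.

The kernel annihilator `t` of `E(ℚ)_tors` produced by `annihilatorCheck` (gcd of the kernel point counts
`#Ẽ(𝔽_ℓ)`) is divisible by `4` for every census row whose curve has full rational `2`-torsion, and for
many rows with `E(ℚ)_tors = ℤ/2` — the group ORDERS `#Ẽ(𝔽_ℓ)` cannot see that the exponent is `2`.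
This file adds one kernel-checkable input: a good odd prime `q₀` at which `Ẽ(𝔽_{q₀})` has NO ELEMENT
OF ORDER 4, tested as `noOrder4 V q₀` = "every non-zero `2`-torsion abscissa is double-free"
(`xDoubleFree`). Since reduction is injective on prime-to-`q₀` torsion (the tree's
`eq_zero_of_zsmul_eq_zero_of_goodReductionHom_eq_zero`, AEC VII.3.1(b)), `E(ℚ)` then has no point of
order `4` either, so `t = 2^e·m` (`m` odd) improves to the annihilator `2·m` (`u = 1`), and the
coset-witness assembly of `Rank2ObservatoryReductionWitness2/3` applies (`xCosetFree`). Main results: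
`eq_zero_of_reduceMod_eq_zero`, `two_nsmul_eq_zero_of_noOrder4`, `two_mul_nsmul_eq_zero_of_noOrder4`,
`two_le_mordellWeilRank_of_ratCert₄`. Sorry-free; axioms `propext`, `Classical.choice`, `Quot.sound`.
References: Silverman AEC (2009) III.2.3, VII.3.1(b), VIII.6.7; Cremona (1997) §3.5.
-/

-- single-conjunct summit: `Summit.BirchSwinnertonDyer.BirchSwinnertonDyer.…` repeats the name by design
set_option linter.dupNamespace false

namespace Summit.BirchSwinnertonDyer.BirchSwinnertonDyer.Rank2Observatory

open WeierstrassCurve Literature.NumberTheory.EllipticCurves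

section NoOrder4

variable (V : WeierstrassCurve ℤ) (q : ℕ) [Fact q.Prime]

/-- The residue transport `Ẽ(ℤ_q/qℤ_q) →+ Ẽ(ZMod q)` is injective (an `AddEquiv`, an injective
`Point.map` along a field map, an `AddEquiv`). [folklore] -/
theorem residuePointHom_injective : Function.Injective (residuePointHom V q) := by
  classical
  letI := ((PadicInt.residueField (p := q)).toRingHom).toAlgebra
  intro a b h
  simp only [residuePointHom, AddMonoidHom.coe_comp, Function.comp_apply,
    AddEquiv.coe_toAddMonoidHom, EmbeddingLike.apply_eq_iff_eq] at h
  have h2 := Affine.Point.map_injective _ h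
  exact (Affine.Point.congrEquiv _).injective h2

open scoped Classical in
/-- **Reduction is injective on prime-to-`q` torsion** (phrased for `reduceMod`): if `n • P = 0` with
`q ∤ n` and `P ↦ 0 (mod q)` then `P = 0`. [cite: SilvermanAEC2009, Prop. VII.3.1(b)] -/
theorem eq_zero_of_reduceMod_eq_zero (hq : ¬ (q : ℤ) ∣ V.Δ)
    (P : (V.map (Int.castRingHom ℚ)).toAffine.Point) {n : ℕ} (hn : ¬ q ∣ n) (h : n • P = 0)
    (h0 : reduceMod V q hq P = 0) : P = 0 := by
  set φ₁ := Affine.Point.congrEquiv (rat_model_eq V) with hφ₁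
  set φ₂ := Affine.Point.baseChange (W' := V) ℚ ℚ_[q] with hφ₂
  set φ₃ := Affine.Point.congrEquiv (padic_model_eq V q) with hφ₃
  have hred : goodReductionHom _ (padicInt_valuationIntegers q) (isUnit_Δ_map_padicInt V q hq)
      (φ₃ (φ₂ (φ₁ P))) = 0 := by
    apply residuePointHom_injective V q
    rw [map_zero]
    simpa [reduceMod] using h0
  have hnQ : (n : ℤ) • φ₃ (φ₂ (φ₁ P)) = 0 := by
    rw [natCast_zsmul, ← map_nsmul, ← map_nsmul, ← map_nsmul, h, map_zero, map_zero, map_zero]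
  have hv : NormedField.valuation ((n : ℤ) : ℚ_[q]) = 1 := by
    rw [NormedField.valuation_apply, ← NNReal.coe_inj, coe_nnnorm, NNReal.coe_one]
    refine le_antisymm (Padic.norm_int_le_one _) (not_lt.1 fun hlt => hn ?_)
    have hq' : ((q : ℕ) : ℤ) ∣ (n : ℤ) := Padic.norm_intCast_lt_one_iff.1 hlt
    exact_mod_cast hq'
  have hQ : φ₃ (φ₂ (φ₁ P)) = 0 :=
    eq_zero_of_zsmul_eq_zero_of_goodReductionHom_eq_zero (padicInt_valuationIntegers q)
      (isUnit_Δ_map_padicInt V q hq) hv hnQ hred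
  rw [← map_zero φ₃, φ₃.apply_eq_iff_eq, ← map_zero φ₂] at hQ
  have h' := Affine.Point.map_injective _ hQ
  rwa [← map_zero φ₁, φ₁.apply_eq_iff_eq] at h'

/-- NO-ORDER-4 TEST at `q` (a Boolean for `decide`): every affine point `(β, γ)` of `V mod q` with
`2γ + a₁β + a₃ = 0` (a non-zero `2`-torsion point) has a double-free abscissa (`xDoubleFree`), i.e.
no non-zero `2`-torsion point of `Ẽ(𝔽_q)` is a double: `Ẽ(𝔽_q)` has no element of order `4`.
[cite: SilvermanAEC2009, III.2.3] -/
def noOrder4 (V : WeierstrassCurve ℤ) (q : ℕ) [NeZero q] : Bool :=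
  decide (∀ β γ : ZMod q,
    γ ^ 2 + (V.a₁ : ZMod q) * β * γ + (V.a₃ : ZMod q) * γ =
      β ^ 3 + (V.a₂ : ZMod q) * β ^ 2 + (V.a₄ : ZMod q) * β + (V.a₆ : ZMod q) →
    2 * γ + (V.a₁ : ZMod q) * β + (V.a₃ : ZMod q) = 0 → xDoubleFree V q β = true)

/-- Soundness of `noOrder4` in `Ẽ(𝔽_q)`: a point `T` with `2 • T = 0` that is a double `2 • b` is `O`.
[cite: SilvermanAEC2009, III.2.3] -/
theorem eq_zero_of_two_nsmul_eq_zero_of_noOrder4 (h4 : noOrder4 V q = true)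
    (b : (V.map (Int.castRingHom (ZMod q))).toAffine.Point) (hT : 2 • (2 • b) = 0) :
    2 • b = 0 := by
  classical
  simp only [noOrder4, decide_eq_true_eq] at h4
  by_contra hne
  rcases h2b : (2 • b) with _ | ⟨β, γ, hns⟩
  · exact hne h2b
  · have ha₁ : (V.map (Int.castRingHom (ZMod q))).a₁ = (V.a₁ : ZMod q) := by
      simp [WeierstrassCurve.map]
    have ha₂ : (V.map (Int.castRingHom (ZMod q))).a₂ = (V.a₂ : ZMod q) := by
      simp [WeierstrassCurve.map]
    have ha₃ : (V.map (Int.castRingHom (ZMod q))).a₃ = (V.a₃ : ZMod q) := by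
      simp [WeierstrassCurve.map]
    have ha₄ : (V.map (Int.castRingHom (ZMod q))).a₄ = (V.a₄ : ZMod q) := by
      simp [WeierstrassCurve.map]
    have ha₆ : (V.map (Int.castRingHom (ZMod q))).a₆ = (V.a₆ : ZMod q) := by
      simp [WeierstrassCurve.map]
    have heq : γ ^ 2 + (V.a₁ : ZMod q) * β * γ + (V.a₃ : ZMod q) * γ =
        β ^ 3 + (V.a₂ : ZMod q) * β ^ 2 + (V.a₄ : ZMod q) * β + (V.a₆ : ZMod q) := by
      have e := (Affine.equation_iff β γ).mp hns.left
      rwa [ha₁, ha₂, ha₃, ha₄, ha₆] at e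
    -- `2 • T = 0` means `T = -T`, i.e. `γ = negY β γ`
    rw [h2b, two_nsmul] at hT
    have hneg : Affine.Point.some β γ hns = -Affine.Point.some β γ hns := eq_neg_of_add_eq_zero_left hT
    rw [Affine.Point.neg_some, Affine.Point.some.injEq] at hneg
    have h2t : 2 * γ + (V.a₁ : ZMod q) * β + (V.a₃ : ZMod q) = 0 := by
      have hγ := hneg.2
      rw [Affine.negY, ha₁, ha₃] at hγ
      linear_combination hγ
    have hfree := h4 β γ heq h2t
    have hmem : (Affine.Point.some β γ hns : (V.map (Int.castRingHom (ZMod q))).toAffine.Point) ∈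
        twoCoset (V.map (Int.castRingHom (ZMod q))).toAffine.Point 0 := by
      refine ⟨b, 0, by simp, ?_⟩
      rw [← h2b, two_zsmul, two_nsmul, add_zero]
    exact not_mem_twoCoset_of_xDoubleFree V q hfree hns hmem

open scoped Classical in
/-- **No point of order 4 in `E(ℚ)`** when some good odd prime `q` has `noOrder4 V q`: for every
`w ∈ E(ℚ)`, `4 • w = 0 → 2 • w = 0` (reduce `2 • w`: it is `2`-torsion and a double mod `q`, hence `O`
mod `q`, hence `O` by injectivity on prime-to-`q` torsion). [cite: SilvermanAEC2009, Prop. VII.3.1(b)] -/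
theorem two_nsmul_eq_zero_of_noOrder4 (hq : ¬ (q : ℤ) ∣ V.Δ) (hq2 : q ≠ 2)
    (h4 : noOrder4 V q = true) (w : (V.map (Int.castRingHom ℚ)).toAffine.Point) (h : 4 • w = 0) :
    2 • w = 0 := by
  have hn : ¬ q ∣ 2 := fun hd =>
    hq2 ((Nat.prime_dvd_prime_iff_eq (Fact.out : q.Prime) Nat.prime_two).mp hd)
  have h4w : 2 • (2 • w) = 0 := by rw [← mul_nsmul]; exact h
  refine eq_zero_of_reduceMod_eq_zero V q hq (2 • w) hn h4w ?_
  have himg : 2 • (2 • reduceMod V q hq w) = 0 := by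
    rw [← map_nsmul, ← map_nsmul, h4w, map_zero]
  rw [map_nsmul]
  exact eq_zero_of_two_nsmul_eq_zero_of_noOrder4 V q h4 _ himg

open scoped Classical in
/-- **Annihilator sharpening**: if `t = 2^e · m` kills `E(ℚ)_tors` (kernel `annihilatorCheck`) and a
good odd prime `q` has `noOrder4 V q`, then `2 · m` kills `E(ℚ)_tors`.
[cite: SilvermanAEC2009, Prop. VII.3.1(b)] [cite: CremonaAlgorithms1997, §3.5] -/
theorem two_mul_nsmul_eq_zero_of_noOrder4 (hq : ¬ (q : ℤ) ∣ V.Δ) (hq2 : q ≠ 2)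
    (h4 : noOrder4 V q = true) {S : List (ℕ × ℕ)} {t : ℕ}
    (hS : ∀ ℓN ∈ S, ℓN.1.Prime ∧
      ∀ (x : (V.map (Int.castRingHom ℚ)).toAffine.Point) (n : ℕ), ¬ ℓN.1 ∣ n → n • x = 0 →
        ℓN.2 • x = 0)
    (ht : annihilatorCheck S t = true) {e m : ℕ} (hte : t = 2 ^ e * m)
    (x : (V.map (Int.castRingHom ℚ)).toAffine.Point) (hx : IsOfFinAddOrder x) :
    (2 * m) • x = 0 := by
  have htx : t • x = 0 := nsmul_eq_zero_of_annihilatorCheck hS ht hx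
  rw [hte, mul_nsmul'] at htx
  rw [mul_nsmul']
  -- descend: `2^(k+1) • z = 0 → 2 • z = 0`
  have key : ∀ k : ℕ, ∀ z : (V.map (Int.castRingHom ℚ)).toAffine.Point,
      2 ^ (k + 1) • z = 0 → 2 • z = 0 := by
    intro k
    induction k with
    | zero => intro z hz; simpa using hz
    | succ k ih =>
      intro z hz
      apply ih
      have hz4 : 4 • (2 ^ k • z) = 0 := by
        rw [← mul_nsmul', show 4 * 2 ^ k = 2 ^ (k + 1 + 1) by ring]; exact hz
      have h2 := two_nsmul_eq_zero_of_noOrder4 V q hq hq2 h4 (2 ^ k • z) hz4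
      rwa [← mul_nsmul', show 2 * 2 ^ k = 2 ^ (k + 1) by ring] at h2
  cases e with
  | zero => rw [pow_zero, one_nsmul] at htx; rw [htx, nsmul_zero]
  | succ k => exact key k _ htx

end NoOrder4

/-! ### The assembled certificate (rational points, annihilator sharpened to `u = 1`) -/

section Assembly

variable (V : WeierstrassCurve ℤ)

/-- **`2 ≤ rank_ℤ E(ℚ)` from a kernel-checkable certificate with rational points and a torsion
annihilator `t = 2^e · m` (`m` odd, typically `4 ∣ t`) SHARPENED to `2m` by a no-order-4 prime `q₀`**
(`noOrder4 V q₀`), then `u = 1` coset witnesses `xCosetFree` at the residues of `P₁, P₂, P₁ + P₂` as in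
`two_le_mordellWeilRank_of_ratCert₂`. [cite: SilvermanAEC2009, Thm. VIII.6.7]
[cite: CremonaAlgorithms1997, §3.5] -/
theorem two_le_mordellWeilRank_of_ratCert₄ {x₁ y₁ x₂ y₂ x₃ y₃ : ℚ}
    (h₁ : y₁ ^ 2 + (V.a₁ : ℚ) * x₁ * y₁ + (V.a₃ : ℚ) * y₁ =
      x₁ ^ 3 + (V.a₂ : ℚ) * x₁ ^ 2 + (V.a₄ : ℚ) * x₁ + (V.a₆ : ℚ))
    (h₂ : y₂ ^ 2 + (V.a₁ : ℚ) * x₂ * y₂ + (V.a₃ : ℚ) * y₂ =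
      x₂ ^ 3 + (V.a₂ : ℚ) * x₂ ^ 2 + (V.a₄ : ℚ) * x₂ + (V.a₆ : ℚ))
    (h₃ : y₃ ^ 2 + (V.a₁ : ℚ) * x₃ * y₃ + (V.a₃ : ℚ) * y₃ =
      x₃ ^ 3 + (V.a₂ : ℚ) * x₃ ^ 2 + (V.a₄ : ℚ) * x₃ + (V.a₆ : ℚ))
    (hc : ratChord V x₁ y₁ x₂ y₂ x₃ y₃ = true) {S : List (ℕ × ℕ)} {t : ℕ}
    (hS : ∀ ℓN ∈ S, ℓN.1.Prime ∧
      ∀ (x : (V.map (Int.castRingHom ℚ)).toAffine.Point) (n : ℕ), ¬ ℓN.1 ∣ n → n • x = 0 →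
        ℓN.2 • x = 0)
    (ht : annihilatorCheck S t = true) (e m : ℕ) (hte : t = 2 ^ e * m) (hmo : m % 2 = 1)
    (q₀ : ℕ) [Fact q₀.Prime] (hq₀ : ¬ (q₀ : ℤ) ∣ V.Δ) (hq₀2 : q₀ ≠ 2) (h4 : noOrder4 V q₀ = true)
    (q₁ q₂ q₃ : ℕ) [Fact q₁.Prime] [Fact q₂.Prime]
    [Fact q₃.Prime] (hq₁ : ¬ (q₁ : ℤ) ∣ V.Δ) (hq₂ : ¬ (q₂ : ℤ) ∣ V.Δ) (hq₃ : ¬ (q₃ : ℤ) ∣ V.Δ)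
    (hd₁ : ¬ q₁ ∣ x₁.den ∧ ¬ q₁ ∣ y₁.den) (hd₂ : ¬ q₂ ∣ x₂.den ∧ ¬ q₂ ∣ y₂.den)
    (hd₃ : ¬ q₃ ∣ x₃.den ∧ ¬ q₃ ∣ y₃.den) (m₁ n₁ m₂ n₂ m₃ n₃ : ℤ)
    (hm₁ : (q₁ : ℤ) ∣ x₁.num - m₁ * x₁.den ∧ (q₁ : ℤ) ∣ y₁.num - n₁ * y₁.den)
    (hm₂ : (q₂ : ℤ) ∣ x₂.num - m₂ * x₂.den ∧ (q₂ : ℤ) ∣ y₂.num - n₂ * y₂.den)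
    (hm₃ : (q₃ : ℤ) ∣ x₃.num - m₃ * x₃.den ∧ (q₃ : ℤ) ∣ y₃.num - n₃ * y₃.den)
    (hw₁ : xCosetFree V q₁ (m₁ : ZMod q₁) (n₁ : ZMod q₁) = true)
    (hw₂ : xCosetFree V q₂ (m₂ : ZMod q₂) (n₂ : ZMod q₂) = true)
    (hw₃ : xCosetFree V q₃ (m₃ : ZMod q₃) (n₃ : ZMod q₃) = true) :
    2 ≤ (V.map (Int.castRingHom ℚ)).mordellWeilRank := by
  classical
  have hΔ : V.Δ ≠ 0 := Δ_ne_zero_of_not_dvd V hq₁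
  haveI := isElliptic_rat V hΔ
  have hm : Odd (m : ℤ) := Int.odd_iff.mpr (by omega)
  have htors : ∀ x : (V.map (Int.castRingHom ℚ)).toAffine.Point, IsOfFinAddOrder x →
      ((2 : ℤ) ^ 1 * (m : ℤ)) • x = 0 := by
    intro x hx
    have h := two_mul_nsmul_eq_zero_of_noOrder4 V q₀ hq₀ hq₀2 h4 hS ht hte x hx
    rw [pow_one, show ((2 : ℤ) * (m : ℤ)) = ((2 * m : ℕ) : ℤ) by push_cast; ring, natCast_zsmul]
    exact h
  refine two_le_mordellWeilRank_of_cosetWitness (V.map (Int.castRingHom ℚ)) hm htors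
    (P₁ := .some _ _ (nonsingular_rat_of_eq_rat V hΔ h₁))
    (P₂ := .some _ _ (nonsingular_rat_of_eq_rat V hΔ h₂))
    (reduceMod V q₁ hq₁) (reduceMod V q₂ hq₂) (reduceMod V q₃ hq₃) ?_ ?_ ?_
  · obtain ⟨h', e⟩ := reduceMod_some_rat V q₁ hq₁ (nonsingular_rat_of_eq_rat V hΔ h₁) hd₁.1 hd₁.2
      hm₁.1 hm₁.2
    rw [e]
    exact not_mem_twoCoset_one_of_xCosetFree V q₁ hw₁ _
  · obtain ⟨h', e⟩ := reduceMod_some_rat V q₂ hq₂ (nonsingular_rat_of_eq_rat V hΔ h₂) hd₂.1 hd₂.2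
      hm₂.1 hm₂.2
    rw [e]
    exact not_mem_twoCoset_one_of_xCosetFree V q₂ hw₂ _
  · rw [some_add_some_of_ratChord V hΔ h₁ h₂ h₃ hc]
    obtain ⟨h', e⟩ := reduceMod_some_rat V q₃ hq₃ (nonsingular_rat_of_eq_rat V hΔ h₃) hd₃.1 hd₃.2
      hm₃.1 hm₃.2
    rw [e]
    exact not_mem_twoCoset_one_of_xCosetFree V q₃ hw₃ _

end Assembly

end Summit.BirchSwinnertonDyer.BirchSwinnertonDyer.Rank2Observatory
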